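import Summits.KontsevichZagierPeriods.KontsevichZagierPeriods.Theorems.LogKernelConjecture.Negative.Sandwich
import Literature.NumberTheory.Transcendental.KZProductIdeal
import Literature.NumberTheory.Transcendental.KZLogCalculusProofs

/-!
# `LogKernelConjecture` (stmt-KontsevichZagierPeriods-2837) — negative knowledge, part 6: the five-rule period ring

* §12 KILL SHAPE (d): under the crux, the five-rule periods cancel non-zero periods
  (`cancellation_of_logKernelConjecture`, `KZ.eval_mul'`); a five-rule cancellation gap
  (`c * s ∈ logClosure`, `eval s ≠ 0`, `c ∉ logClosure`) would kill crux and summit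
  (`not_logKernelConjecture_of_cancellationGap`) — none is known.
* §13 **`logClosure` is a two-sided ideal** of `FormalRep` (`mul_mem_logClosure_left/right`,
  `mul_sub_mul_mem_logClosure`): the left product of a logarithmic instance by a generator `[υ, g]`
  is again a logarithmic instance (`of_mul_mem_logNLInstances`; base `υ × τ`, coefficients
  `g(y)·hᵢ(x)`, same `Vᵢ`, fibre coordinate still last), and right products follow from
  commutativity modulo `KZ.relations` (`KZ.mul_sub_mul_comm_mem_relations`).  So the five-rule
  periods `FormalRep ⧸ logClosure` form a commutative ring with multiplicative `eval`, as the
  four-rule formal period ring does: route Neg's ring-theoretic pressure points transfer verbatim,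
  and the cancellation kill shape is intrinsic (`mul_mem_logClosure_iff_of_logKernelConjecture`).
* §14 `logClosure` is stable under the scaling endomorphisms `KZ.scale q` (`q` real algebraic), and
  logarithmic instances are symmetric modulo relations (`−d ≡ scale (−1) d`).
[cite: KontsevichZagierPeriods2001, §4.1]
-/

noncomputable section

open MeasureTheory Set
open Literature.NumberTheory.Transcendental

namespace Summit.KontsevichZagierPeriods.LiouvilleUnfolding.LogKernelConjectureNegative

open Summit.KontsevichZagierPeriods.KontsevichZagierPeriods.Theses.LiouvilleUnfolding
  (LogKernelConjecture LogPrimitiveNL)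

/-! ## §12 Kill shape (d): cancellation by a non-zero period (route Neg's pressure point, five rules) -/

/-- **Under the crux the five-rule periods cancel non-zero periods**: `eval s ≠ 0` and
`c * s ∈ logClosure` give `c ∈ logClosure` (`eval` is multiplicative, `KZ.eval_mul'`). [folklore] -/
theorem cancellation_of_logKernelConjecture (h : LogKernelConjecture) {c s : KZ.FormalRep}
    (hs : KZ.eval s ≠ 0) (hcs : c * s ∈ logClosure) : c ∈ logClosure := by
  rw [logKernelConjecture_iff_ker_le] at h
  apply h
  have h0 : KZ.eval (c * s) = 0 := (AddMonoidHom.mem_ker).1 (logClosure_le_ker hcs)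
  rw [KZ.eval_mul'] at h0
  exact (AddMonoidHom.mem_ker).2 ((mul_eq_zero.1 h0).resolve_right hs)

/-- **KILL SHAPE (d)**: a five-rule CANCELLATION GAP — `c * s` derivable by the five rules, `s` of
non-zero value, `c` not derivable — refutes the crux and the summit.  (Route Neg's `CancellationGap`
is the four-rule version; a four-rule gap whose `c` becomes derivable with logarithmic primitives
does NOT kill this crux.) No instance is known. [folklore] -/
theorem not_logKernelConjecture_of_cancellationGap
    (h : ∃ c s : KZ.FormalRep, KZ.eval s ≠ 0 ∧ c * s ∈ logClosure ∧ c ∉ logClosure) :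
    ¬ LogKernelConjecture ∧ ¬ KontsevichZagierPeriods := by
  obtain ⟨c, s, hs, hcs, hc⟩ := h
  have h1 : ¬ LogKernelConjecture := fun hk => hc (cancellation_of_logKernelConjecture hk hs hcs)
  exact ⟨h1, not_summit_of_not_logKernelConjecture h1⟩


/-! ## §13 `logClosure` is a two-sided ideal: the five-rule periods form a ring

Multiplying a logarithmic instance ON THE LEFT by a generator `[υ, g]` gives again a logarithmic
instance (the fibre coordinate stays last: base `υ × τ`, coefficients `g(y)·hᵢ(x)`, the same `Vᵢ`);
right products follow from commutativity modulo `KZ.relations`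
(`KZ.mul_sub_mul_comm_mem_relations`), and `KZ.relations` is itself a two-sided ideal
(`KZ.mul_mem_relations_left/right_holds`).  Hence `FormalRep ⧸ logClosure` is a commutative ring
onto which `eval` descends multiplicatively, exactly like the four-rule formal period ring: route
Neg's ring-theoretic pressure points (cancellation, nilpotents, zero divisors) transfer verbatim to
the five-rule calculus, and the kill shape (d) of §12 is intrinsic. -/

section Ideal

variable {m n : ℕ}

/-- Index bookkeeping: `castAdd (n+1) i = castSucc (castAdd n i)` in `Fin (m + n + 1)`. [folklore] -/
lemma castAdd_succ_eq (i : Fin m) :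
    (Fin.castAdd (n + 1) i : Fin (m + n + 1)) = Fin.castSucc (Fin.castAdd n i) := Fin.ext rfl

/-- Index bookkeeping: `natAdd m (castSucc j) = castSucc (natAdd m j)`. [folklore] -/
lemma natAdd_castSucc_eq (j : Fin n) :
    (Fin.natAdd m (Fin.castSucc j) : Fin (m + n + 1)) = Fin.castSucc (Fin.natAdd m j) := Fin.ext rfl

/-- Index bookkeeping: `natAdd m (last n) = last (m + n)`. [folklore] -/
lemma natAdd_last_eq : (Fin.natAdd m (Fin.last n) : Fin (m + n + 1)) = Fin.last (m + n) :=
  Fin.ext rfl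

/-- First block of `snoc w t` is the first block of `w`. [folklore] -/
lemma fst_snoc (w : Fin (m + n) → ℝ) (t : ℝ) :
    (fun i : Fin m => (Fin.snoc w t : Fin (m + n + 1) → ℝ) (Fin.castAdd (n + 1) i)) =
      fun i => w (Fin.castAdd n i) := by
  funext i
  rw [castAdd_succ_eq, Fin.snoc_castSucc]

/-- Second block of `snoc w t` is `snoc` of the second block of `w`. [folklore] -/
lemma snd_snoc (w : Fin (m + n) → ℝ) (t : ℝ) :
    (fun j : Fin (n + 1) => (Fin.snoc w t : Fin (m + n + 1) → ℝ) (Fin.natAdd m j)) =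
      Fin.snoc (fun j => w (Fin.natAdd m j)) t := by
  funext j
  refine Fin.lastCases ?_ (fun j' => ?_) j
  · rw [natAdd_last_eq, Fin.snoc_last, Fin.snoc_last]
  · rw [natAdd_castSucc_eq, Fin.snoc_castSucc, Fin.snoc_castSucc]

/-- A function semialgebraic on `r.domain` stays semialgebraic on `υ × r.domain` when read on the
second block of coordinates (coordinate preimage of the graph; no Tarski–Seidenberg). [folklore] -/
lemma isSemialgebraicFunOn_comp_snd {l : ℕ} (s₀ : KZ.IntegralRep m) (r : KZ.IntegralRep l)
    {f : (Fin l → ℝ) → ℝ} (hf : IsSemialgebraicFunOn ℚ r.domain f) :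
    IsSemialgebraicFunOn ℚ (KZ.IntegralRep.prodDomain s₀ r)
      (fun z => f fun j => z (Fin.natAdd m j)) := by
  rw [isSemialgebraicFunOn_iff]
  let ρ : Fin (l + 1) → Fin (m + l + 1) :=
    Fin.lastCases (Fin.last (m + l)) fun j => Fin.castSucc (Fin.natAdd m j)
  have hΓ := (isSemialgebraicFunOn_iff.mp hf).preimage_comp ρ
  convert (KZ.IntegralRep.isSemialgebraic_prodDomain s₀ r).setOf_init_mem.inter hΓ using 1
  have hinit : ∀ w : Fin (m + l + 1) → ℝ,
      Fin.init (w ∘ ρ) = fun j => Fin.init w (Fin.natAdd m j) := by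
    intro w; ext j; simp [Fin.init, ρ]
  have hlast : ∀ w : Fin (m + l + 1) → ℝ, (w ∘ ρ) (Fin.last l) = w (Fin.last (m + l)) := by
    intro w; simp [ρ]
  ext w
  simp only [mem_setOf_eq, mem_inter_iff, mem_preimage, hinit, hlast,
    KZ.IntegralRep.mem_prodDomain]
  tauto

/-- Tonelli for a tensor product `g ⊗ φ` of integrable functions on `υ × σ`. [folklore] -/
lemma integrableOn_tensor {l : ℕ} (s₀ : KZ.IntegralRep m) (r : KZ.IntegralRep l)
    {φ : (Fin l → ℝ) → ℝ} (hφ : IntegrableOn φ r.domain) :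
    IntegrableOn (fun z : Fin (m + l) → ℝ =>
      s₀.integrand (fun i => z (Fin.castAdd l i)) * φ (fun j => z (Fin.natAdd m j)))
      (KZ.IntegralRep.prodDomain s₀ r) := by
  have hint : IntegrableOn (fun p : (Fin m → ℝ) × (Fin l → ℝ) => s₀.integrand p.1 * φ p.2)
      (s₀.domain ×ˢ r.domain) := by
    rw [IntegrableOn, Measure.volume_eq_prod, ← Measure.prod_restrict]
    exact s₀.integrableOn.mul_prod hφ
  have hcomp : (fun z : Fin (m + l) → ℝ =>
      s₀.integrand (fun i => z (Fin.castAdd l i)) * φ (fun j => z (Fin.natAdd m j))) ∘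
        KZ.appendMeasurableEquiv m l = fun p => s₀.integrand p.1 * φ p.2 := by
    funext p
    simp
  rw [← KZ.IntegralRep.preimage_prodDomain, ← hcomp] at hint
  exact (KZ.volume_preserving_appendMeasurableEquiv.integrableOn_comp_preimage
    (KZ.appendMeasurableEquiv m l).measurableEmbedding).mp hint

/-- **Left products of logarithmic instances are logarithmic instances**:
`[υ, g] · ([r] − [r']) = [υ × r] − [υ × r'] ∈ logNLInstances`. [folklore] -/
theorem of_mul_mem_logNLInstances (s₀ : KZ.IntegralRep m) {d : KZ.FormalRep}
    (hd : d ∈ logNLInstances) : KZ.of s₀ * d ∈ logNLInstances := by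
  obtain ⟨n, k, r, r', a, b, h, V, V', ha, hb, hab, hdom, hh, hV, hpos, hcont, hder, hint, hr, hr',
    rfl⟩ := hd
  -- the new data
  refine ⟨m + n, k, s₀.prod r, s₀.prod r', fun w => a fun j => w (Fin.natAdd m j),
    fun w => b fun j => w (Fin.natAdd m j),
    fun i w => s₀.integrand (fun i' => w (Fin.castAdd n i')) * h i (fun j => w (Fin.natAdd m j)),
    fun i z => V i fun j => z (Fin.natAdd m j), fun i z => V' i fun j => z (Fin.natAdd m j),
    ?_, ?_, ?_, ?_, ?_, ?_, ?_, ?_, ?_, ?_, ?_, ?_, ?_⟩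
  · exact isSemialgebraicFunOn_comp_snd s₀ r' ha
  · exact isSemialgebraicFunOn_comp_snd s₀ r' hb
  · intro w hw
    exact hab _ hw.2
  · -- the band equation
    ext z
    simp only [KZ.IntegralRep.prod_domain, KZ.IntegralRep.mem_prodDomain, hdom, Set.mem_setOf_eq]
    exact ⟨fun ⟨h1, h2, h3, h4⟩ => ⟨⟨h1, h2⟩, h3, h4⟩, fun ⟨⟨h1, h2⟩, h3, h4⟩ => ⟨h1, h2, h3, h4⟩⟩
  · intro i
    exact IsSemialgebraicFunOn.mul_holds (KZ.IntegralRep.isSemialgebraicFunOn_fst s₀ r')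
      (isSemialgebraicFunOn_comp_snd s₀ r' (hh i))
  · intro i
    exact isSemialgebraicFunOn_comp_snd s₀ r (hV i)
  · intro i z hz
    exact hpos i _ hz.2
  · intro i w hw
    simp only [snd_snoc]
    exact hcont i _ hw.2
  · intro i w hw t ht
    simp only [snd_snoc]
    exact hder i _ hw.2 t ht
  · intro i
    have heq : (fun z : Fin (m + n + 1) → ℝ =>
        s₀.integrand (fun i' => Fin.init z (Fin.castAdd n i')) *
            h i (fun j => Fin.init z (Fin.natAdd m j)) *
          V' i (fun j => z (Fin.natAdd m j)) / V i (fun j => z (Fin.natAdd m j))) =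
        fun z : Fin (m + (n + 1)) → ℝ => s₀.integrand (fun i' => z (Fin.castAdd (n + 1) i')) *
          ((fun y : Fin (n + 1) → ℝ => h i (Fin.init y) * V' i y / V i y)
            (fun j => z (Fin.natAdd m j))) := by
      funext z
      have e1 : (fun i' => Fin.init z (Fin.castAdd n i')) = fun i' => z (Fin.castAdd (n + 1) i') :=
        rfl
      have e2 : (fun j => Fin.init z (Fin.natAdd m j)) = Fin.init (fun j => z (Fin.natAdd m j)) :=
        rfl
      simp only [e1, e2]
      ring
    rw [KZ.IntegralRep.prod_domain, heq]
    exact integrableOn_tensor s₀ r (hint i)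
  · intro w hw t ht
    rw [KZ.IntegralRep.prod_integrand_eq, KZ.IntegralRep.prodFun_apply, fst_snoc, snd_snoc,
      hr _ hw.2 t ht, Finset.mul_sum]
    simp only [snd_snoc]
    exact Finset.sum_congr rfl fun i _ => by ring
  · intro w hw
    rw [KZ.IntegralRep.prod_integrand_eq, KZ.IntegralRep.prodFun_apply, hr' _ hw.2, Finset.mul_sum]
    simp only [snd_snoc]
    exact Finset.sum_congr rfl fun i _ => by ring
  · rw [mul_sub, KZ.of_mul_of, KZ.of_mul_of]

/-- **`logClosure` is a left ideal**: `d ∈ logClosure → c * d ∈ logClosure`. [folklore] -/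
theorem mul_mem_logClosure_left (c : KZ.FormalRep) {d : KZ.FormalRep} (hd : d ∈ logClosure) :
    c * d ∈ logClosure := by
  induction hd using AddSubgroup.closure_induction generalizing c with
  | mem x hx =>
    rcases hx with hx | hx
    · exact relations_le_logClosure (KZ.mul_mem_relations_left_holds x c hx)
    · induction c using FreeAbelianGroup.induction_on with
      | zero => rw [zero_mul]; exact logClosure.zero_mem
      | of p =>
        obtain ⟨l, s₀⟩ := p
        exact logNLInstances_subset_logClosure (of_mul_mem_logNLInstances s₀ hx)
      | neg p hp => rw [neg_mul]; exact logClosure.neg_mem hp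
      | add u v hu hv => rw [add_mul]; exact logClosure.add_mem hu hv
  | zero => rw [mul_zero]; exact logClosure.zero_mem
  | add x y _ _ hx hy => rw [mul_add]; exact logClosure.add_mem (hx c) (hy c)
  | neg x _ hx => rw [mul_neg]; exact logClosure.neg_mem (hx c)

/-- **`logClosure` is a right ideal** (left ideal + commutativity modulo `KZ.relations`).
[folklore] -/
theorem mul_mem_logClosure_right (c : KZ.FormalRep) {d : KZ.FormalRep} (hd : d ∈ logClosure) :
    d * c ∈ logClosure := by
  have h1 : d * c - c * d ∈ logClosure := relations_le_logClosure (KZ.mul_sub_mul_comm_mem_relations d c)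
  have := logClosure.add_mem h1 (mul_mem_logClosure_left c hd)
  simpa using this

/-- **Two-sided ideal**: congruent factors have congruent products modulo `logClosure`.
[folklore] -/
theorem mul_sub_mul_mem_logClosure {c₁ c₂ d₁ d₂ : KZ.FormalRep} (hc : c₁ - c₂ ∈ logClosure)
    (hd : d₁ - d₂ ∈ logClosure) : c₁ * d₁ - c₂ * d₂ ∈ logClosure := by
  have h1 : (c₁ - c₂) * d₁ ∈ logClosure := mul_mem_logClosure_right d₁ hc
  have h2 : c₂ * (d₁ - d₂) ∈ logClosure := mul_mem_logClosure_left c₂ hd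
  have := logClosure.add_mem h1 h2
  have heq : (c₁ - c₂) * d₁ + c₂ * (d₁ - d₂) = c₁ * d₁ - c₂ * d₂ := by
    rw [sub_mul, mul_sub]; abel
  rwa [heq] at this

/-- The cancellation kill shape (d) is intrinsic: under the crux, `c * s ∈ logClosure` with
`eval s ≠ 0` forces `c ∈ logClosure`, and conversely `c ∈ logClosure → c * s ∈ logClosure` holds
unconditionally (right ideal). [folklore] -/
theorem mul_mem_logClosure_iff_of_logKernelConjecture (h : LogKernelConjecture) {c s : KZ.FormalRep}
    (hs : KZ.eval s ≠ 0) : c * s ∈ logClosure ↔ c ∈ logClosure :=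
  ⟨cancellation_of_logKernelConjecture h hs, mul_mem_logClosure_right s⟩

end Ideal

/-! ## §14 Stability under the scaling endomorphisms; instances are symmetric modulo relations -/

section Scaling

variable (q : ℝ) (hq : IsAlgebraic ℚ q)

/-- **Scaling a logarithmic instance by a real algebraic constant gives a logarithmic instance**
(`hᵢ ↦ q hᵢ`, same band, same `Vᵢ`): `KZ.scale q` maps `logNLInstances` into itself. [folklore] -/
theorem scale_mem_logNLInstances {d : KZ.FormalRep} (hd : d ∈ logNLInstances) :
    KZ.scale q hq d ∈ logNLInstances := by
  obtain ⟨n, k, r, r', a, b, h, V, V', ha, hb, hab, hdom, hh, hV, hpos, hcont, hder, hint, hr, hr',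
    rfl⟩ := hd
  rw [map_sub, KZ.scale_of, KZ.scale_of]
  refine ⟨n, k, r.constMul q hq, r'.constMul q hq, a, b, fun i x => q * h i x, V, V', ha, hb, hab,
    hdom, ?_, hV, hpos, hcont, hder, ?_, ?_, ?_, rfl⟩
  · intro i
    exact IsSemialgebraicFunOn.mul_holds
      (isSemialgebraicFunOn_const_of_isAlgebraic r'.isSemialgebraic_domain hq) (hh i)
  · intro i
    have heq : (fun z : Fin (n + 1) → ℝ => q * h i (Fin.init z) * V' i z / V i z) =
        fun z => q * (h i (Fin.init z) * V' i z / V i z) := by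
      funext z; ring
    rw [KZ.IntegralRep.domain_constMul, heq]
    exact (hint i).const_mul _
  · intro x hx t ht
    rw [KZ.IntegralRep.domain_constMul] at hx
    simp only [KZ.IntegralRep.integrand_constMul]
    rw [hr x hx t ht, Finset.mul_sum]
    exact Finset.sum_congr rfl fun i _ => by ring
  · intro x hx
    rw [KZ.IntegralRep.domain_constMul] at hx
    simp only [KZ.IntegralRep.integrand_constMul]
    rw [hr' x hx, Finset.mul_sum]
    exact Finset.sum_congr rfl fun i _ => by ring

/-- **`logClosure` is stable under every scaling endomorphism** `[σ, f] ↦ [σ, q f]`, `q` real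
algebraic (`KZ.scale_mem_relations` for the four-rule part). [folklore] -/
theorem scale_mem_logClosure {c : KZ.FormalRep} (hc : c ∈ logClosure) :
    KZ.scale q hq c ∈ logClosure := by
  have h : logClosure ≤ logClosure.comap (KZ.scale q hq) := by
    rw [logClosure, AddSubgroup.closure_le]
    rintro x (hx | hx)
    · exact relations_le_logClosure (KZ.scale_mem_relations q hq hx)
    · exact logNLInstances_subset_logClosure (scale_mem_logNLInstances q hq hx)
  exact h hc

end Scaling

/-- `scale (−1) c ≡ −c` modulo `KZ.relations` (integrand additivity with the negative
representation). [folklore] -/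
theorem scale_neg_one_add_mem_relations (c : KZ.FormalRep) :
    KZ.scale (-1) (isAlgebraic_one.neg) c + c ∈ KZ.relations := by
  induction c using FreeAbelianGroup.induction_on with
  | zero => simp [KZ.relations.zero_mem]
  | of p =>
    obtain ⟨n, r⟩ := p
    change KZ.scale (-1) isAlgebraic_one.neg (KZ.of r) + KZ.of r ∈ KZ.relations
    rw [KZ.scale_of, add_comm]
    exact KZ.of_add_of_mem_relations_of_eqOn_neg (r := r)
      (r' := r.constMul (-1) isAlgebraic_one.neg) rfl (fun x _ => by simp)
  | neg p hp =>
    have : KZ.scale (-1) isAlgebraic_one.neg (-FreeAbelianGroup.of p) + -FreeAbelianGroup.of p =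
        -(KZ.scale (-1) isAlgebraic_one.neg (FreeAbelianGroup.of p) + FreeAbelianGroup.of p) := by
      rw [map_neg]; abel
    rw [this]
    exact KZ.relations.neg_mem hp
  | add x y hx hy =>
    have : KZ.scale (-1) isAlgebraic_one.neg (x + y) + (x + y) =
        (KZ.scale (-1) isAlgebraic_one.neg x + x) + (KZ.scale (-1) isAlgebraic_one.neg y + y) := by
      rw [map_add]; abel
    rw [this]
    exact KZ.relations.add_mem hx hy

/-- **Logarithmic instances are symmetric modulo relations**: `−d ≡ scale (−1) d ∈ logNLInstances`.
So the subgroup `logClosure` is already `KZ.relations +` (ℕ-combinations of instances); with the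
gluing of same-dimensional instances along disjoint translated bases and dimension-raising by left
products with `[[0,1], 1]` (§13) one expects the normal form "every element of `logClosure` is ONE
instance modulo `KZ.relations`" — i.e. the crux should say: two equal-valued representations differ,
modulo the four rules, by a SINGLE logarithmic Newton–Leibniz step (gluing not formalised here).
[folklore] -/
theorem neg_mem_logNLInstances_mod_relations {d : KZ.FormalRep} (hd : d ∈ logNLInstances) :
    ∃ d' ∈ logNLInstances, -d - d' ∈ KZ.relations := by
  refine ⟨KZ.scale (-1) isAlgebraic_one.neg d, scale_mem_logNLInstances _ _ hd, ?_⟩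
  have h := KZ.relations.neg_mem (scale_neg_one_add_mem_relations d)
  have heq : -(KZ.scale (-1) isAlgebraic_one.neg d + d) = -d - KZ.scale (-1) isAlgebraic_one.neg d := by
    abel
  rwa [heq] at h

end Summit.KontsevichZagierPeriods.LiouvilleUnfolding.LogKernelConjectureNegative
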